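import Mathlib.Data.ZMod.Basic
import Mathlib.Data.Nat.Choose.Basic
import Mathlib.Algebra.Group.Even
import Mathlib.Tactic.Ring
import Mathlib.Tactic.Linarith
import Mathlib.Tactic.NormNum
import Mathlib.Tactic.FieldSimp
import Mathlib.Tactic.LinearCombination
import Mathlib.Tactic.Positivity
import HarnessLib

/-!
# Ring 2 / AbelianAll — charge lines of Schoen components on a quaternionic Prym sixfold (WEIL-2 gen 64, PROPOSITION J)

research route, not a corollary; conditional on HC_CM plus one named minimal statement.
`HC_CM` occurs nowhere in this file; nothing here is a case of the Hodge conjecture.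

Fact-free combinatorial and arithmetic core of PROPOSITION J of the account `AXIS-G64.md` (pub-hodge-ring2,
seat ab-weil-2, gen 64), which decides CHECK C2 of vhodge-p3's quaternionic door (memo ROUTE-P3-g22 §7,
ROUTE-P3-g23 §3) in the NEGATIVE: on the (2,1)-tower quaternionic Prym sixfold `P` (`Q₈ ⊂ Aut C̃`,
axis `i`, `K = ℚ(i)`), the four Schoen threefolds `Z_t`, `t ∈ ℤ/4`, have `W_i`-charges on the two
«coordinate» lines of the `K`-line `W_i` — the lines stable under the involution `j_*`, which in a
suitable `K`-frame acts on the coordinate `λ ∈ K` by complex conjugation — whereas the Vandermonde class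
`r_i` has coordinate `1 - i`, whose line is not conjugation-stable.

Three ingredients are certified here.
* §1 (labels).  `j x j⁻¹ = x⁻¹` and `j² = x²` give, for a lift `D̃ = Σₖ (p̃ₖ + x^{aₖ} j p̃ₖ)` of a
  `j̄`-invariant reduced divisor, the total position difference `Σₖ (2 - 2aₖ) = 6 - 2Σaₖ` between `jD̃`
  and `D̃`, which is EVEN; re-choosing the lift shows `j` acts on packet labels by `t ↦ -t + τ` with `τ`
  even, so it preserves `t mod 2` and fixes two packets (`sigma_*`, `tau_even`, `packet_shift_even`).
* §2 (lines in a `ℚ(i)`-line).  Writing `λ = a + b i` with `a b : ℚ`: the `ℚ`-line of `λ ≠ 0` is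
  conjugation-stable iff `a b = 0` (`conj_stable_iff`); `1 - i` is not (`vandermonde_unstable`);
  `ℚλ ≠ ℚ(iλ)` (`line_i_mul_ne`); and `λ₀ - iλ₀ = a(1 - i)` for `λ₀ = a` (`diff_on_vandermonde`).
* §3 (numbers).  THEOREM Q ∕ REMARK Q′ of HECKE-NUMBERS-G60 read at `(h, m, |H|, D, e) =
  (6, 4, 1, 32, 2)`: `⟨P̄_t, ĥ³⟩ = C(6,3)·3!·m²·e³ = 15360`, `∫ĥ⁶ = 6!e⁶/D = 1440`, `q̄ = 32/3`,
  `L̄² = 163840`, `w̄_t² = 2m⁴D = 16384 = 128²`, `P̄² = 180224`, `w̄²/L̄² = 1/10`; and the same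
  closed form at `(8, 12, ·, ·, 12)` returns THEOREM Q's `60 197 437 440` (`hdegree_general_f12`).
-/

namespace Summit.HodgeConjecture.Ring2AbelianAll.SchoenChargeLines

/-! ## §1 How `j` permutes Schoen's packets -/

/-- The total position difference between `jD̃` and `D̃` over a `j̄`-invariant reduced divisor with
three `j̄`-orbits: over `pₖ` it is `2 - aₖ` (from `j x^{aₖ} j = x^{2-aₖ}`), over `j̄pₖ` it is `-aₖ`. -/
theorem packet_shift_sum (a₁ a₂ a₃ : ℤ) :
    ((2 - a₁) + (-a₁)) + ((2 - a₂) + (-a₂)) + ((2 - a₃) + (-a₃)) = 6 - 2 * (a₁ + a₂ + a₃) := by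
  ring

/-- That total difference is even: `j` maps every lift of such a divisor into a packet of the same
parity. -/
theorem packet_shift_even (a₁ a₂ a₃ : ℤ) : Even (6 - 2 * (a₁ + a₂ + a₃)) :=
  ⟨3 - (a₁ + a₂ + a₃), by ring⟩

/-- Re-choosing the lift: if the label moves by `B` (`t' = t + B`) then `Σaₖ` moves by the same `B`
(`A' = A + B`), and the label of the image `t' + (6 - 2A')` is an AFFINE function `-t' + τ` of `t'`
with `τ = 6 - 2A + 2t` independent of the lift. -/
theorem sigma_formula (t A B : ℤ) :
    (t + B) + (6 - 2 * (A + B)) = -(t + B) + (6 - 2 * A + 2 * t) := by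
  ring

/-- The translation part `τ = 6 - 2A + 2t` of `σ_j(t) = -t + τ` is even. -/
theorem tau_even (t A : ℤ) : Even (6 - 2 * A + 2 * t) :=
  ⟨3 - A + t, by ring⟩

/-- On `ℤ/4`: an involution `t ↦ -t + τ` with `τ` even preserves the parity of every label
(`σ(t) - t ∈ {0, 2}`) … -/
theorem sigma_preserves_parity :
    ∀ τ t : ZMod 4, (τ = 0 ∨ τ = 2) → ((-t + τ) - t = 0 ∨ (-t + τ) - t = 2) := by
  decide

/-- … and fixes exactly the two labels `τ/2`, `τ/2 + 2` (here listed for `τ = 0` and `τ = 2`). -/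
theorem sigma_fixed_points :
    (∀ t : ZMod 4, (-t + 0 = t ↔ (t = 0 ∨ t = 2))) ∧ (∀ t : ZMod 4, (-t + 2 = t ↔ (t = 1 ∨ t = 3))) := by
  decide

/-- Whereas an involution `t ↦ -t + τ` with `τ` ODD has no fixed label and flips every parity (the
case that would have been needed for a Vandermonde slope). -/
theorem sigma_odd_no_fixed_point :
    ∀ τ t : ZMod 4, (τ = 1 ∨ τ = 3) → (-t + τ ≠ t ∧ ((-t + τ) - t = 1 ∨ (-t + τ) - t = 3)) := by
  decide

/-- `k = x j` shifts every image label by `6 ≡ 2 (mod 4)` more (`x` acts on all six points), so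
`τ_k = τ_j + 2`: `k` fixes the two packets that `j` swaps. -/
theorem tau_k_shift : ∀ τ : ZMod 4, (τ = 0 ∨ τ = 2) → (τ + 6 = 2 ∨ τ + 6 = 0) := by
  decide

/-! ## §2 `ℚ`-lines in a `ℚ(i)`-line under complex conjugation
We write an element of `K = ℚ(i)` as `a + b i` with `a b : ℚ`; complex conjugation is `(a, b) ↦ (a, -b)`,
multiplication by `i` is `(a, b) ↦ (-b, a)`.  «The `ℚ`-line of `λ` is conjugation-stable» means
`conj λ = q λ` for some `q : ℚ`. -/

/-- The `ℚ`-line through `λ = a + bi ≠ 0` is stable under conjugation iff `ab = 0`, i.e. iff `λ` is on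
one of the two coordinate lines `ℚ` or `iℚ`. -/
theorem conj_stable_iff (a b : ℚ) (h : a ≠ 0 ∨ b ≠ 0) :
    (∃ q : ℚ, a = q * a ∧ -b = q * b) ↔ a * b = 0 := by
  constructor
  · rintro ⟨q, ha, hb⟩
    rcases h with ha0 | hb0
    · have hq : q = 1 := by
        have : (q - 1) * a = 0 := by linarith
        rcases mul_eq_zero.mp this with h1 | h1
        · linarith
        · exact absurd h1 ha0
      subst hq
      have : b = 0 := by linarith
      simp [this]
    · have hq : q = -1 := by
        have : (q + 1) * b = 0 := by linarith
        rcases mul_eq_zero.mp this with h1 | h1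
        · linarith
        · exact absurd h1 hb0
      subst hq
      have : a = 0 := by linarith
      simp [this]
  · intro hab
    rcases mul_eq_zero.mp hab with ha0 | hb0
    · exact ⟨-1, by rw [ha0]; ring, by ring⟩
    · exact ⟨1, by ring, by rw [hb0]; ring⟩

/-- On a conjugation-stable line the involution acts by `+1` (the line `ℚ`, `b = 0`) or by `-1`
(the line `iℚ`, `a = 0`). -/
theorem conj_sign_on_axes (a b q : ℚ) (h : a ≠ 0 ∨ b ≠ 0) (hq : a = q * a ∧ -b = q * b) :
    (q = 1 ∧ b = 0) ∨ (q = -1 ∧ a = 0) := by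
  rcases h with ha0 | hb0
  · have hq1 : q = 1 := by
      have : (q - 1) * a = 0 := by linarith [hq.1]
      rcases mul_eq_zero.mp this with h1 | h1
      · linarith
      · exact absurd h1 ha0
    left; refine ⟨hq1, ?_⟩; subst hq1; linarith [hq.2]
  · have hq1 : q = -1 := by
      have : (q + 1) * b = 0 := by linarith [hq.2]
      rcases mul_eq_zero.mp this with h1 | h1
      · linarith
      · exact absurd h1 hb0
    right; refine ⟨hq1, ?_⟩; subst hq1; linarith [hq.1]

/-- The Vandermonde coordinate `1 - i` (`a = 1`, `b = -1`): its line is NOT conjugation-stable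
(`conj(1 - i) = 1 + i = i·(1 - i)`). -/
theorem vandermonde_unstable : ¬ ∃ q : ℚ, (1 : ℚ) = q * 1 ∧ -(-1 : ℚ) = q * (-1) := by
  rintro ⟨q, h1, h2⟩
  linarith

/-- Its twin `1 + i` is not stable either. -/
theorem vandermonde_twin_unstable : ¬ ∃ q : ℚ, (1 : ℚ) = q * 1 ∧ -(1 : ℚ) = q * 1 := by
  rintro ⟨q, h1, h2⟩
  linarith

/-- `ℚλ ≠ ℚ(iλ)` for `λ ≠ 0`: consecutive Schoen packets (`α_{t+1} = i·α_t`) are charged on DIFFERENT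
lines. -/
theorem line_i_mul_ne (a b : ℚ) (h : a ≠ 0 ∨ b ≠ 0) : ¬ ∃ q : ℚ, -b = q * a ∧ a = q * b := by
  rintro ⟨q, h1, h2⟩
  have key : (q ^ 2 + 1) * b = 0 := by linear_combination (-q) * h2 + (-1) * h1
  have hq : q ^ 2 + 1 ≠ 0 := by positivity
  have hb : b = 0 := by
    rcases mul_eq_zero.mp key with h3 | h3
    · exact absurd h3 hq
    · exact h3
  have ha : a = 0 := by rw [h2, hb]; ring
  rcases h with h' | h' <;> contradiction

/-- `ℚλ = ℚ(-λ)`: packets `t` and `t + 2` (`α_{t+2} = -α_t`) are charged on the SAME line. -/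
theorem line_neg_eq (a b : ℚ) : ∃ q : ℚ, -a = q * a ∧ -b = q * b :=
  ⟨-1, by ring, by ring⟩

/-- If the line of `λ₀ = a + bi` is conjugation-stable with sign `+1` then `λ₀ = a` is «real», the next
packet's coordinate is `iλ₀ = ai`, and the DIFFERENCE `λ₀ - iλ₀ = a·(1 - i)` lies on the Vandermonde
line, the SUM `λ₀ + iλ₀ = a·(1 + i)` on its twin. -/
theorem diff_on_vandermonde (a : ℚ) :
    ((a - 0, 0 - a) : ℚ × ℚ) = (a * 1, a * (-1)) ∧ ((a + 0, 0 + a) : ℚ × ℚ) = (a * 1, a * 1) := by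
  constructor <;> ext <;> simp

/-! ## §3 The numbers: THEOREM Q at `(h, m, |H|, D, e) = (6, 4, 1, 32, 2)` -/

/-- h-degree law `⟨P̄_t, ĥ^{h/2}⟩ = C(h,h/2)·(h/2)!·m^{h/2-1}·e^{h/2}` at `h = 6`, `m = 4`, `e = 2`. -/
theorem hdegree_641 : Nat.choose 6 3 * Nat.factorial 3 * 4 ^ 2 * 2 ^ 3 = 15360 := by
  decide

/-- Cross-check of the same closed form at THEOREM Q's own parameters `h = 8`, `m = 12`, `e = 12`:
`C(8,4)·4!·12³·12⁴ = 60 197 437 440` — the number printed in HECKE-NUMBERS-G60 §2 (i). -/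
theorem hdegree_general_f12 : Nat.choose 8 4 * Nat.factorial 4 * 12 ^ 3 * 12 ^ 4 = 60197437440 := by
  norm_num [Nat.choose, Nat.factorial]

/-- Top self-intersection of the dual polarization: `∫_Â ĥ⁶ = 6!·e⁶/D = 1440` (type `(1,2,2,2,2,2)`,
`D = 32`, `e = 2`; exact division). -/
theorem top_power_641 : Nat.factorial 6 * 2 ^ 6 / 32 = 1440 ∧ 32 ∣ Nat.factorial 6 * 2 ^ 6 := by
  refine ⟨by decide, ⟨1440, by decide⟩⟩

/-- `q̄ = ⟨P̄,ĥ³⟩/∫ĥ⁶ = 32/3` and the closed form `q̄ = m^{h/2-1}D/((h/2)!·e^{h/2}) = 4²·32/(3!·2³)`. -/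
theorem qbar_641 : (15360 : ℚ) / 1440 = 32 / 3 ∧ (4 : ℚ) ^ 2 * 32 / (6 * 2 ^ 3) = 32 / 3 := by
  constructor <;> norm_num

/-- `L̄² = q̄²∫ĥ⁶ = q̄·⟨P̄,ĥ³⟩ = 163840 = C(6,3)·m⁴·D`. -/
theorem Lbar_sq_641 :
    (32 / 3 : ℚ) ^ 2 * 1440 = 163840 ∧ (32 / 3 : ℚ) * 15360 = 163840 ∧ 20 * 4 ^ 4 * 32 = 163840 := by
  refine ⟨by norm_num, by norm_num, by norm_num⟩

/-- Weil norm `w̄_t² = 2·m^{h-2}·|P_τ(t)|²·D/|H|^h = 2·4⁴·1·32/1 = 16384 = 128² = 2¹⁴` — a perfect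
square, the same for all four packets. -/
theorem weil_norm_641 : 2 * 4 ^ 4 * 1 * 32 / 1 ^ 6 = 16384 ∧ 16384 = 128 ^ 2 ∧ 16384 = 2 ^ 14 := by
  refine ⟨by norm_num, by norm_num, by norm_num⟩

/-- `P̄_t² = L̄² + w̄² = 180224 = 5632·D` and `w̄²/L̄² = 1/10 = 2|P_τ|²/(C(6,3)·|H|⁶)` (at `h = 8`
the same ratio `2|P_τ|²/(C(8,4)|H|⁸)` is REMARK Q′'s `|P_τ|²/(35|H|⁸)`). -/
theorem total_and_ratio_641 :
    163840 + 16384 = 180224 ∧ 180224 = 5632 * 32 ∧ (16384 : ℚ) / 163840 = 1 / 10 ∧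
      (2 : ℚ) * 1 / (Nat.choose 6 3 * 1 ^ 6) = 1 / 10 ∧ (2 : ℚ) / Nat.choose 8 4 = 1 / 35 := by
  refine ⟨by norm_num, by norm_num, by norm_num, ?_, ?_⟩
  · rw [show Nat.choose 6 3 = 20 by decide]
    norm_num
  · rw [show Nat.choose 8 4 = 70 by decide]
    norm_num

/-- Model change to `P` by the `N_P`-route isogeny of degree `e^{2h}/D² = 2¹²/32² = 4` (a square, so
`ℚ`-lines and square classes of self-intersections are unchanged). -/
theorem model_change_degree_641 : 2 ^ 12 / 32 ^ 2 = 4 ∧ 32 ^ 2 ∣ 2 ^ 12 ∧ 4 = 2 ^ 2 := by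
  refine ⟨by norm_num, ⟨4, by norm_num⟩, by norm_num⟩

end Summit.HodgeConjecture.Ring2AbelianAll.SchoenChargeLines
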